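import Literature.NumberTheory.EllipticCurves.Voight2007.RingClassGenusFieldContainment
import Literature.NumberTheory.EllipticCurves.Voight2007.RingClassGenusField
import Literature.NumberTheory.EllipticCurves.RingClassFieldTower
import Literature.NumberTheory.NumberFields.RingClassFieldQuadraticSymbol
import Literature.NumberTheory.QuadraticFields.RingClassNumber
import HarnessLib

/-!
# Voight 2007, Prop. 3.8 HOLDS: which `√m` lie in the ring class field `K[f]` — the genus class
# field of modulus `f` (discharge of the named fact `prop38_sqrt_mem_ringClassField_iff`)

Topic `NumberTheory/EllipticCurves/Voight2007`. THEOREMS only; this file makes the named fact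
`prop38_sqrt_mem_ringClassField_iff` (`RingClassGenusField.lean`: J. Voight, *Quadratic forms that
represent almost the same primes*, Math. Comp. 76 (2007), §3 Prop. 3.8 with Prop. 3.1, 3.7, Cor. 3.9–3.10,
AS PRINTED) a THEOREM, `prop38_sqrt_mem_ringClassField_iff_holds`: for `K` imaginary quadratic,
`f ≥ 1`, `m` fundamental, `n = disc ℚ(√(d_K m))` (`d_K m = n s²`): `(∃ r ∈ K[f], r² = m) ↔ m n ∣ d_K f²`.
Structure (all inputs tree THEOREMS): the criterion is "every odd prime factor of `m` divides `d_K`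
or `f`, and the dyadic table of Cor. 3.9" (`mul_dvd_mul_sq_iff_odd_and_table`); (⟸) is
`exists_sq_eq_intCast_ringClassField_of_table` (Bauer + Cox Thm. 11.1 + genus characters); (⟹) at an
odd `q ∣ m`, `q ∤ d_K f` is ramification (`sqrt_intCast_not_mem_ringClassField`) —
`dvd_or_dvd_of_sq_eq_ringClassField`; (⟹) at `2` is ARTIN RECIPROCITY: `√m ∈ K[F]` forces
`(m / N(α)) = 1` for `α ≡ 1 (mod F𝓞_K)`, `N(α)` odd, prime to `m`
(`jacobiSym_absNorm_eq_one_of_sq_eq_of_ringClassField`, transported along `K[F] ≅ R_F`), while in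
each case excluded by the table an explicit `α = x + yω` (`F ∈ {f, 2f, 4f}`, `K[f] ⊆ K[F]`,
`y = F w_m`) has `N(α) ≡ 3, 5, 7 (mod 8)`, `≡ 1 (mod w_m)`, so `(m/N(α)) = −1` —
`table_of_sq_eq_ringClassField`. (The sibling file `RingClassGenusFieldProofs.lean`, u2-lit, proves
the odd-`m` / odd-`d_K` cases by ring-class degrees; it is not used here.)
HONEST FRAMING: classical class field theory (genus theory of orders), on the tree's proved CFT of
`K[f]`; for the cell `bsd-uniform` the last genus-theory named fact of the U2 trust base (referee
V23 F23-3) becomes a theorem; nothing about elliptic curves or `L`-functions; no cell number changes.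
Mathlib / tree search: tree `exists_classField_algEquiv_ringClassField`, `ringClassField_mono`,
`RingClass.finite_ringClassGroup`, `sqrt_intCast_not_mem_ringClassField`, the `Voight2007.*` lemmas of
`GenusFieldCriterionArithmetic/Residues/…Containment`; Mathlib `ZMod.χ₈_nat_eq_if_mod_eight`,
`Nat.exists_eq_two_pow_mul_odd`.

## References

* J. Voight, *Quadratic forms that represent almost the same primes*, Math. Comp. 76 (2007), §3
  Prop. 3.1, Prop. 3.7, Prop. 3.8, Cor. 3.9–3.10. [Voight2007]
* D. A. Cox, *Primes of the form x² + ny²*, 2nd ed. (2013): §6.A Thm. 6.1, §9.A (pp. 180–181),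
  §11.A Thm. 11.1. [Cox2013]
-/

noncomputable section

open NumberField IsDedekindDomain IsDedekindDomain.HeightOneSpectrum Filter Polynomial ZMod
open scoped nonZeroDivisors IntermediateField

namespace Literature.NumberTheory.EllipticCurves

namespace Voight2007

open Literature.NumberTheory.GaloisRepresentations Literature.NumberTheory.NumberFields
open Literature.NumberTheory.NumberFields.RingClassField
open Literature.NumberTheory.QuadraticFields.RingClass Literature.NumberTheory.QuadraticFields.Quadratic

variable {K : Type} [Field K] [NumberField K]

/-- An odd square is `≡ 1 (mod 8)`. [folklore] -/
private theorem sq_emod_eight_of_odd {x : ℤ} (hx : Odd x) : x ^ 2 % 8 = 1 := by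
  obtain ⟨c, rfl⟩ := hx
  obtain ⟨e, he⟩ := Int.even_mul_succ_self c
  have : (2 * c + 1) ^ 2 = 4 * (c * (c + 1)) + 1 := by ring
  rw [this, he]
  omega

/-- **Voight 2007 Prop. 3.8 / Cor. 3.10, direction ⟹ at the odd primes:** if `K[f]` contains a
square root of the fundamental discriminant `m = 2^{k_m} w_m`, then every odd prime factor `q` of
`m` divides `d_K` or `f` (otherwise `q` is unramified in `K[f]` but ramified in `K(√m)`, the tree's
`sqrt_intCast_not_mem_ringClassField`). [cite: Voight2007, §3 Prop. 3.8 and Cor. 3.10] -/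
theorem dvd_or_dvd_of_sq_eq_ringClassField (hK : IsImaginaryQuadratic K) (ι : K →+* ℂ) {f : ℕ}
    (hf : f ≠ 0) {m : ℤ} {km : ℕ} {wm : ℤ} (hmd : m = 2 ^ km * wm) (hsqm : Squarefree wm)
    (r : ringClassField K ι f) (hr : r ^ 2 = (m : ringClassField K ι f))
    {q : ℕ} (hq : q.Prime) (hq2 : q ≠ 2) (hqm : (q : ℤ) ∣ m) :
    (q : ℤ) ∣ NumberField.discr K ∨ q ∣ f := by
  by_contra h
  push Not at h
  obtain ⟨hqd, hqf⟩ := h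
  have hQ : Prime (q : ℤ) := Nat.prime_iff_prime_int.mp hq
  have hq2' : ¬ (q : ℤ) ∣ 2 := by
    intro h2
    have h3 : q ∣ 2 := by exact_mod_cast h2
    rcases (Nat.dvd_prime Nat.prime_two).mp h3 with h4 | h4
    · exact hq.one_lt.ne' h4
    · exact hq2 h4
  have hcop : IsCoprime (q : ℤ) (2 ^ km) := ((Prime.coprime_iff_not_dvd hQ).mpr hq2').pow_right
  have hqm2 : ¬ (q : ℤ) ^ 2 ∣ m := by
    intro h2
    rw [hmd] at h2
    have h1 : (q : ℤ) ^ 2 ∣ wm := hcop.pow_left.dvd_of_dvd_mul_left h2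
    exact hQ.not_unit (hsqm (q : ℤ) (by rw [← sq]; exact h1))
  have hr' : ((r : ℂ)) ^ 2 = (m : ℂ) := by simpa using congrArg Subtype.val hr
  exact sqrt_intCast_not_mem_ringClassField hK ι hf hq hqm hqm2 hqf hqd (r : ℂ) hr' r.2

/-- **`(m / N(α)) = 1` for `α ≡ 1 (mod F)` when `√m ∈ K[F]`** (the tree's
`jacobiSym_absNorm_eq_one_of_sq_eq_of_ringClassField`, transported along Cox's Thm. 11.1
`K[F] ≅ R_F`). [cite: Cox2013, §9.A (pp. 180–181) and §11.A Thm. 11.1] -/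
theorem jacobiSym_eq_one_of_sq_eq_ringClassField (hK : IsImaginaryQuadratic K) (ι : K →+* ℂ)
    {F : ℕ} (hF : F ≠ 0) {m : ℤ} (hm0 : m ≠ 0)
    (r : ringClassField K ι F) (hr : r ^ 2 = (m : ringClassField K ι F))
    {α : 𝓞 K} (hα : α - 1 ∈ Ideal.span {(F : 𝓞 K)})
    (hodd : Odd (Ideal.absNorm (Ideal.span {α})))
    (hcop : IsCoprime ((Ideal.absNorm (Ideal.span {α}) : ℕ) : ℤ) m) :
    jacobiSym m (Ideal.absNorm (Ideal.span {α})) = 1 := by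
  classical
  obtain ⟨R, hfd, hgal, hunr, hsplit, ⟨e⟩⟩ := exists_classField_algEquiv_ringClassField hK ι hF
  haveI := hfd; haveI := hgal
  haveI : Finite (RingClassGroup K F) := finite_ringClassGroup (f := F) hK.finrank_eq_two hF
  set r' : R := e.symm r with hr'def
  have hr' : r' ^ 2 = (m : R) := by
    rw [hr'def, ← map_pow, hr, map_intCast]
  have hα' : α - ((1 : ℤ) : 𝓞 K) ∈ Ideal.span {(F : 𝓞 K)} := by simpa using hα
  exact jacobiSym_absNorm_eq_one_of_sq_eq_of_ringClassField F hF R hunr hsplit hm0 r' hr'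
    isCoprime_one_left hα' hodd hcop

/-- **Voight 2007 Prop. 3.8 / Cor. 3.9, direction ⟹ at the prime `2`:** if `K[f]` contains a square
root of `m = 2^{k_m} w_m`, the dyadic table holds. PROOF: in each failing case an explicit
`α = 1 + y·ϑ ∈ ℤ + F𝓞_K` (`F ∈ {f, 2f, 4f}`, `K[f] ⊆ K[F]`; `ϑ = ω` resp. `ω − t/2`,
`y = F·w_m`) has `N(α) ≡ 3, 5` or `7 (mod 8)` and `N(α) ≡ 1 (mod w_m)`, so `(m/N(α)) = −1` by
reciprocity — contradicting `jacobiSym_eq_one_of_sq_eq_ringClassField`.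
[cite: Voight2007, §3 Prop. 3.8 and Cor. 3.9] -/
theorem table_of_sq_eq_ringClassField (hK : IsImaginaryQuadratic K) (ι : K →+* ℂ) {f : ℕ}
    (hf : f ≠ 0) {m : ℤ} {km : ℕ} {wm : ℤ} (hmd : m = 2 ^ km * wm) (hwm : Odd wm)
    (hkm : (km = 0 ∧ wm % 4 = 1) ∨ (km = 2 ∧ wm % 4 = 3) ∨ km = 3)
    {kd : ℕ} {wd : ℤ} (hdd : NumberField.discr K = 2 ^ kd * wd) (hwd : Odd wd)
    (hkd : (kd = 0 ∧ wd % 4 = 1) ∨ (kd = 2 ∧ wd % 4 = 3) ∨ kd = 3)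
    (r : ringClassField K ι f) (hr : r ^ 2 = (m : ringClassField K ι f)) :
    km = 0 ∨ (km = 2 ∧ ((kd = 0 ∧ 4 ∣ f) ∨ kd = 2 ∨ (kd = 3 ∧ 2 ∣ f))) ∨
      (km = 3 ∧ ((kd = 0 ∧ 8 ∣ f) ∨ (kd = 2 ∧ 4 ∣ f) ∨
        (kd = 3 ∧ (wm % 4 = wd % 4 ∨ 2 ∣ f)))) := by
  classical
  have hwm0 : wm ≠ 0 := by rintro rfl; exact absurd hwm (by decide)
  have hm0 : m ≠ 0 := by rw [hmd]; exact mul_ne_zero (pow_ne_zero _ two_ne_zero) hwm0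
  set d : ℤ := NumberField.discr K with hddef
  obtain ⟨b, hb⟩ := exists_basis_zero_eq_one (K := K) hK.finrank_eq_two
  set m₀ : ℤ := b.repr (b 1 * b 1) 0 with hm₀
  set t : ℤ := b.repr (b 1 * b 1) 1 with ht
  have hω : b 1 * b 1 = (m₀ : 𝓞 K) + (t : 𝓞 K) * b 1 := basis_one_mul_self_eq b hb
  have hdisc : d = t ^ 2 + 4 * m₀ := discr_eq_sq_add_four_mul b hb
  have key : ∀ F : ℕ, F ≠ 0 → f ∣ F → ∀ x y : ℤ, (F : ℤ) ∣ x - 1 → (F : ℤ) ∣ y →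
      wm ∣ x - 1 → wm ∣ y →
      ∃ N : ℕ, (N : ℤ) = x ^ 2 + t * x * y - m₀ * y ^ 2 ∧
        (Odd N → (χ₈ (N : ZMod 8)) ^ km * (if wm % 4 = 1 then 1 else χ₄ (N : ZMod 4)) = 1) := by
    intro F hF hfF x y hFx hFy hwx hwy
    set α : 𝓞 K := (x : 𝓞 K) + (y : 𝓞 K) * b 1 with hαdef
    have hnorm : Algebra.norm ℤ α = x ^ 2 + t * x * y - m₀ * y ^ 2 :=
      norm_intCast_add_intCast_mul b hb hω x y
    have hnn : 0 ≤ Algebra.norm ℤ α := by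
      rw [hnorm]
      nlinarith [sq_nonneg (2 * x + t * y), sq_nonneg y, hdisc, hK.discr_neg]
    set N : ℕ := Ideal.absNorm (Ideal.span {α}) with hNdef
    have hN : (N : ℤ) = x ^ 2 + t * x * y - m₀ * y ^ 2 := by
      rw [hNdef, Ideal.absNorm_span_singleton, Int.natCast_natAbs, abs_of_nonneg hnn, hnorm]
    refine ⟨N, hN, fun hoddN => ?_⟩
    obtain ⟨c, hc⟩ := hFx
    obtain ⟨e', he'⟩ := hFy
    have hα : α - 1 ∈ Ideal.span {(F : 𝓞 K)} := by
      have hx' : x = F * c + 1 := by linarith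
      rw [show α - 1 = (F : 𝓞 K) * ((c : 𝓞 K) + (e' : 𝓞 K) * b 1) by
        rw [hαdef, hx', he']; push_cast; ring]
      exact Ideal.mul_mem_right _ _ (Ideal.mem_span_singleton_self _)
    obtain ⟨c₁, hc₁⟩ := hwx
    obtain ⟨e₁, he₁⟩ := hwy
    have hNsub : (N : ℤ) - 1 = wm * (c₁ * (x + 1) + t * x * e₁ - m₀ * e₁ * y) := by
      rw [hN]
      linear_combination (x + 1) * hc₁ + (t * x - m₀ * y) * he₁
    have hcopN : IsCoprime ((N : ℕ) : ℤ) m := by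
      rw [hmd]
      refine IsCoprime.mul_right ?_ ?_
      · obtain ⟨c₂, hc₂⟩ := hoddN
        refine IsCoprime.pow_right ⟨1, -(c₂ : ℤ), ?_⟩
        push_cast [hc₂]
        ring
      · refine ⟨1, -(c₁ * (x + 1) + t * x * e₁ - m₀ * e₁ * y), ?_⟩
        linear_combination hNsub
    have hle : ringClassField K ι f ≤ ringClassField K ι F := ringClassField_mono hK ι hfF hF
    set rF : ringClassField K ι F := ⟨(r : ℂ), hle r.2⟩ with hrF
    have hrF2 : rF ^ 2 = (m : ringClassField K ι F) := by
      apply Subtype.ext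
      have := congrArg Subtype.val hr
      simpa [hrF] using this
    have hJ1 := jacobiSym_eq_one_of_sq_eq_ringClassField hK ι hF hm0 rF hrF2 hα hoddN hcopN
    have hJw : jacobiSym (N : ℤ) wm.natAbs = 1 := by
      apply jacobiSym_eq_one_of_emod_eq_one
      have hdvd : (wm.natAbs : ℤ) ∣ (N : ℤ) - 1 := by
        rw [Int.natAbs_dvd, hNsub]
        exact dvd_mul_right _ _
      exact Int.modEq_iff_dvd.mpr (by
        rw [show (1 : ℤ) - N = -((N : ℤ) - 1) by ring]
        exact (dvd_neg).mpr hdvd)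
    rw [hmd, jacobiSym_two_pow_mul_eq hwm hoddN hJw] at hJ1
    exact hJ1
  have hteven : kd = 2 ∨ kd = 3 → ∃ t' : ℤ, t = t' + t' := by
    intro hkd'
    rcases Int.even_or_odd t with ht' | htodd
    · exact ht'
    · exfalso
      have h8 := sq_emod_eight_of_odd htodd
      have hd' : d = 2 ^ kd * wd := hdd
      rcases hkd' with rfl | rfl
      · norm_num at hd'
        omega
      · norm_num at hd'
        omega
  have hχ₈sq : ∀ N : ℕ, Odd N → χ₈ (N : ZMod 8) ^ 2 = 1 := fun N hN => by
    have := Nat.odd_iff.mp hN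
    rw [χ₈_nat_eq_if_mod_eight, if_neg (by omega)]
    split_ifs <;> norm_num
  have hF2 : ¬ 4 ∣ f → ∃ F : ℕ, F ≠ 0 ∧ f ∣ F ∧ ∃ F₁ : ℕ, F = 2 * F₁ ∧ Odd F₁ := by
    intro h4
    rcases Nat.even_or_odd f with ⟨f₁, hf₁⟩ | hfodd
    · refine ⟨f, hf, dvd_rfl, f₁, by omega, ?_⟩
      rcases Nat.even_or_odd f₁ with ⟨g, hg⟩ | hodd1
      · exact absurd (⟨g, by omega⟩ : 4 ∣ f) h4
      · exact hodd1
    · exact ⟨2 * f, by omega, Dvd.intro_left 2 rfl, f, rfl, hfodd⟩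
  have hF4 : ¬ 8 ∣ f → ∃ F : ℕ, F ≠ 0 ∧ f ∣ F ∧ ∃ F₁ : ℕ, F = 4 * F₁ ∧ Odd F₁ := by
    intro h8
    obtain ⟨kf, f₁, hf₁, hfk⟩ := Nat.exists_eq_two_pow_mul_odd hf
    have hkf : kf ≤ 2 := by
      by_contra hlt
      push Not at hlt
      apply h8
      rw [hfk, show (8 : ℕ) = 2 ^ 3 by norm_num]
      exact (Nat.pow_dvd_pow 2 hlt).mul_right f₁
    refine ⟨4 * f₁, ?_, ?_, f₁, rfl, hf₁⟩
    · have : f₁ ≠ 0 := by rintro rfl; simp at hfk; exact hf hfk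
      omega
    · rw [hfk, show (4 : ℕ) = 2 ^ 2 by norm_num]
      exact mul_dvd_mul (Nat.pow_dvd_pow 2 hkf) dvd_rfl
  rcases hkm with ⟨hk, hw⟩ | ⟨hk, hw⟩ | hk
  · exact Or.inl hk
  · -- `4 ∥ m`
    refine Or.inr (Or.inl ⟨hk, ?_⟩)
    rcases hkd with ⟨hkd0, hwd1⟩ | ⟨hkd2, -⟩ | hkd3
    · refine Or.inl ⟨hkd0, ?_⟩
      by_contra h4
      obtain ⟨F, hF0, hfF, F₁, hFdef, hF₁⟩ := hF2 h4
      obtain ⟨N, hN, hNJ⟩ := key F hF0 hfF 1 ((F : ℤ) * wm) (by simp) (dvd_mul_right _ _)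
        (by simp) (dvd_mul_left _ _)
      have htodd : Odd t := by
        rcases Int.even_or_odd t with ⟨t', ht'⟩ | h
        · exfalso
          have hd' : d = 2 ^ kd * wd := hdd
          rw [hkd0] at hd'
          have := Int.odd_iff.mp hwd
          have h2 : d = 4 * (t' ^ 2 + m₀) := by rw [hdisc, ht']; ring
          omega
        · exact h
      have hF₁Z : Odd (F₁ : ℤ) := by exact_mod_cast hF₁
      obtain ⟨c, hc⟩ := htodd.mul (hF₁Z.mul hwm)
      have hNe : (N : ℤ) = 1 + 2 * (2 * c + 1) - 4 * (m₀ * ((F₁ : ℤ) * wm) ^ 2) := by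
        rw [hN, ← hc, hFdef]; push_cast; ring
      have hNodd : Odd N := Nat.odd_iff.mpr (by omega)
      have := hNJ hNodd
      rw [hk, if_neg (by omega), hχ₈sq N hNodd, χ₄_nat_three_mod_four (by omega)] at this
      norm_num at this
    · exact Or.inr (Or.inl hkd2)
    · refine Or.inr (Or.inr ⟨hkd3, ?_⟩)
      by_contra h2
      obtain ⟨t', ht'⟩ := hteven (Or.inr hkd3)
      have hd' : d = 2 ^ kd * wd := hdd
      rw [hkd3] at hd'
      norm_num at hd'
      have hm₀' : m₀ = 2 * wd - t' ^ 2 := by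
        have : 8 * wd = (t' + t') ^ 2 + 4 * m₀ := by rw [← hd', hdisc, ht']
        linarith
      set y : ℤ := (f : ℤ) * wm with hydef
      obtain ⟨N, hN, hNJ⟩ := key f hf dvd_rfl (1 - y * t') y ⟨-(wm * t'), by rw [hydef]; ring⟩
        (dvd_mul_right _ _) ⟨-((f : ℤ) * t'), by rw [hydef]; ring⟩ (dvd_mul_left _ _)
      have hNe : (N : ℤ) = 1 - 2 * wd * y ^ 2 := by rw [hN, ht', hm₀']; ring
      have hfodd : Odd f := Nat.odd_iff.mpr (Nat.two_dvd_ne_zero.mp h2)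
      have hyodd : Odd y := by
        rw [hydef]
        exact (by exact_mod_cast hfodd : Odd (f : ℤ)).mul hwm
      have h8 := sq_emod_eight_of_odd hyodd
      obtain ⟨c, hc⟩ : ∃ c : ℤ, y ^ 2 = 8 * c + 1 := ⟨y ^ 2 / 8, by omega⟩
      have hNe' : (N : ℤ) = 1 - 2 * wd - 16 * (wd * c) := by rw [hNe, hc]; ring
      have hwd4 : wd % 4 = 1 ∨ wd % 4 = 3 := by have := Int.odd_iff.mp hwd; omega
      have hNodd : Odd N := Nat.odd_iff.mpr (by omega)
      have := hNJ hNodd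
      rw [hk, if_neg (by omega), hχ₈sq N hNodd, χ₄_nat_three_mod_four (by omega)] at this
      norm_num at this
  · -- `8 ∣ m`
    refine Or.inr (Or.inr ⟨hk, ?_⟩)
    have hwm4 : wm % 4 = 1 ∨ wm % 4 = 3 := by have := Int.odd_iff.mp hwm; omega
    rcases hkd with ⟨hkd0, hwd1⟩ | ⟨hkd2, hwd3⟩ | hkd3
    · refine Or.inl ⟨hkd0, ?_⟩
      by_contra h8
      obtain ⟨F, hF0, hfF, F₁, hFdef, hF₁⟩ := hF4 h8
      obtain ⟨N, hN, hNJ⟩ := key F hF0 hfF 1 ((F : ℤ) * wm) (by simp) (dvd_mul_right _ _)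
        (by simp) (dvd_mul_left _ _)
      have htodd : Odd t := by
        rcases Int.even_or_odd t with ⟨t', ht'⟩ | h
        · exfalso
          have hd' : d = 2 ^ kd * wd := hdd
          rw [hkd0] at hd'
          have := Int.odd_iff.mp hwd
          have h2 : d = 4 * (t' ^ 2 + m₀) := by rw [hdisc, ht']; ring
          omega
        · exact h
      have hF₁Z : Odd (F₁ : ℤ) := by exact_mod_cast hF₁
      obtain ⟨c, hc⟩ := htodd.mul (hF₁Z.mul hwm)
      have hNe : (N : ℤ) = 1 + 4 * (2 * c + 1) - 16 * (m₀ * ((F₁ : ℤ) * wm) ^ 2) := by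
        rw [hN, ← hc, hFdef]; push_cast; ring
      have hNodd : Odd N := Nat.odd_iff.mpr (by omega)
      have := hNJ hNodd
      rw [hk, χ₈_nat_eq_if_mod_eight, if_neg (by omega), if_neg (by omega)] at this
      split_ifs at this with hw1
      · norm_num at this
      · rw [χ₄_nat_one_mod_four (by omega)] at this
        norm_num at this
    · refine Or.inr (Or.inl ⟨hkd2, ?_⟩)
      by_contra h4
      obtain ⟨F, hF0, hfF, F₁, hFdef, hF₁⟩ := hF2 h4
      obtain ⟨t', ht'⟩ := hteven (Or.inl hkd2)
      have hd' : d = 2 ^ kd * wd := hdd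
      rw [hkd2] at hd'
      norm_num at hd'
      have hm₀' : m₀ = wd - t' ^ 2 := by
        have : 4 * wd = (t' + t') ^ 2 + 4 * m₀ := by rw [← hd', hdisc, ht']
        linarith
      set y : ℤ := (F : ℤ) * wm with hydef
      obtain ⟨N, hN, hNJ⟩ := key F hF0 hfF (1 - y * t') y ⟨-(wm * t'), by rw [hydef]; ring⟩
        (dvd_mul_right _ _) ⟨-((F : ℤ) * t'), by rw [hydef]; ring⟩ (dvd_mul_left _ _)
      have hNe : (N : ℤ) = 1 - wd * y ^ 2 := by rw [hN, ht', hm₀']; ring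
      have hF₁Z : Odd (F₁ : ℤ) := by exact_mod_cast hF₁
      obtain ⟨c, hc⟩ := hwd.mul ((hF₁Z.mul hwm).pow (n := 2))
      have hNe' : (N : ℤ) = 1 - 4 * (2 * c + 1) := by
        rw [hNe, ← hc, hydef, hFdef]; push_cast; ring
      have hNodd : Odd N := Nat.odd_iff.mpr (by omega)
      have := hNJ hNodd
      rw [hk, χ₈_nat_eq_if_mod_eight, if_neg (by omega), if_neg (by omega)] at this
      split_ifs at this with hw1
      · norm_num at this
      · rw [χ₄_nat_one_mod_four (by omega)] at this
        norm_num at this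
    · refine Or.inr (Or.inr ⟨hkd3, ?_⟩)
      by_contra hno
      push Not at hno
      obtain ⟨hne, h2⟩ := hno
      obtain ⟨t', ht'⟩ := hteven (Or.inr hkd3)
      have hd' : d = 2 ^ kd * wd := hdd
      rw [hkd3] at hd'
      norm_num at hd'
      have hm₀' : m₀ = 2 * wd - t' ^ 2 := by
        have : 8 * wd = (t' + t') ^ 2 + 4 * m₀ := by rw [← hd', hdisc, ht']
        linarith
      set y : ℤ := (f : ℤ) * wm with hydef
      obtain ⟨N, hN, hNJ⟩ := key f hf dvd_rfl (1 - y * t') y ⟨-(wm * t'), by rw [hydef]; ring⟩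
        (dvd_mul_right _ _) ⟨-((f : ℤ) * t'), by rw [hydef]; ring⟩ (dvd_mul_left _ _)
      have hNe : (N : ℤ) = 1 - 2 * wd * y ^ 2 := by rw [hN, ht', hm₀']; ring
      have hfodd : Odd f := Nat.odd_iff.mpr (Nat.two_dvd_ne_zero.mp h2)
      have hyodd : Odd y := by
        rw [hydef]
        exact (by exact_mod_cast hfodd : Odd (f : ℤ)).mul hwm
      have h8 := sq_emod_eight_of_odd hyodd
      obtain ⟨c, hc⟩ : ∃ c : ℤ, y ^ 2 = 8 * c + 1 := ⟨y ^ 2 / 8, by omega⟩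
      have hNe' : (N : ℤ) = 1 - 2 * wd - 16 * (wd * c) := by rw [hNe, hc]; ring
      have hwd4 : wd % 4 = 1 ∨ wd % 4 = 3 := by have := Int.odd_iff.mp hwd; omega
      have hNodd : Odd N := Nat.odd_iff.mpr (by omega)
      have := hNJ hNodd
      rw [hk, χ₈_nat_eq_if_mod_eight, if_neg (by omega)] at this
      rcases hwd4 with hwd1 | hwd3
      · -- `N ≡ 7 (mod 8)`, `w_m ≡ 3 (mod 4)`
        rw [if_pos (by omega), if_neg (by omega), χ₄_nat_three_mod_four (by omega)] at this
        norm_num at this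
      · -- `N ≡ 3 (mod 8)`, `w_m ≡ 1 (mod 4)`
        rw [if_neg (by omega), if_pos (by omega)] at this
        norm_num at this

/-- **Voight 2007, Prop. 3.8 HOLDS** (the named fact `prop38_sqrt_mem_ringClassField_iff` of
`RingClassGenusField.lean` is a THEOREM): for `K` imaginary quadratic, `f ≥ 1`, `m` a fundamental
discriminant and `n = disc ℚ(√(d_K m))` (`d_K m = n s²`), the ring class field `K[f]` contains a
square root of `m` iff `m n ∣ d_K f²`. Assembled from the criterion's arithmetic
(`mul_dvd_mul_sq_iff_odd_and_table`), the containment `exists_sq_eq_intCast_ringClassField_of_table`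
(⟸, Bauer + genus characters) and `dvd_or_dvd_of_sq_eq_ringClassField` /
`table_of_sq_eq_ringClassField` (⟹, ramification at odd primes + Artin reciprocity at `2`).
[cite: Voight2007, §3 Prop. 3.8 (with Prop. 3.1, Prop. 3.7, Cor. 3.9–3.10)] -/
theorem prop38_sqrt_mem_ringClassField_iff_holds : prop38_sqrt_mem_ringClassField_iff := by
  intro K _ _ hK ι f hf m n s hm hn hdmn
  obtain ⟨km, wm, hmd, hwm, hsqm, hkm⟩ := exists_two_pow_mul_odd_of_isFundamental (Or.inl hm)
  obtain ⟨kn, wn, hnd, hwn, hsqn, hkn⟩ := exists_two_pow_mul_odd_of_isFundamental hn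
  obtain ⟨kd, wd, hdd, hwd, -, hkd⟩ := exists_two_pow_mul_odd_of_isFundamental
    (Or.inl (isFundamentalDiscriminant_discr (K := K) hK.finrank_eq_two))
  rw [mul_dvd_mul_sq_iff_odd_and_table hf (NumberField.discr_ne_zero K) hdd hmd hnd hwd hwm hwn
    hsqm hsqn hkd hkm hkn hdmn]
  constructor
  · rintro ⟨r, hr⟩
    exact ⟨fun q hq hq2 hqm => dvd_or_dvd_of_sq_eq_ringClassField hK ι hf hmd hsqm r hr hq hq2 hqm,
      table_of_sq_eq_ringClassField hK ι hf hmd hwm hkm hdd hwd hkd r hr⟩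
  · rintro ⟨hodd, hT⟩
    exact exists_sq_eq_intCast_ringClassField_of_table hK ι hf hmd hwm hkm hdd hwd hkd hodd hT

end Voight2007

end Literature.NumberTheory.EllipticCurves

end
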